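import Summits.QuantumFields.YangMills.Theorems.AlphaInputsT3ACv3LinearLiftMatrixTwist
import Summits.QuantumFields.YangMills.Theorems.AlphaInputsT3ACv3LinearLiftMatrixCLM
import HarnessLib

/-!
# `AlphaInputsT3ACv3LinearLiftMatrixTwistS` — (V) THE MATRIX-VALUED PORT OF THE (LL) ENGINE, PART 6: the TWISTED port of ★w2 g2's SUP-SMALL exact lift `liftS` — frames on the
# coefficients (w1's covariant spread) with ★★ a k-UNIFORM EXACTNESS DEFECT `‖Q₁^k(liftSMTw ψ A) − A‖ ≤ (d+1)·C_S·θ·M` (the `L^k` of the average against the `L^{−k}` of the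
# sup-small lift) — cell `ym3-torus`, width seat `ym-ust-19936-w3` (g0); OWNER RULING g24-№4

WHY.  Part 4 (`…LinearLiftMatrixTwist`) typed the twisted kernel port `byEntryTw` and instantiated it on w2's block-constant-gauge lift `lift`, whose exactness defect under frames
`θ`-close to the identity carries an honest factor `(d+1)·L^k` (the lift is `O(M)` on the block faces).  ★w2 g2's `liftS` (`…LinearLiftSmooth(Lin)`, `abs_liftS_le : |liftS k A| ≤
C_S·M∕L^k`) is sup-small, so the same three lines give a k-UNIFORM defect — the form w1's Newton architecture v2 consumes («(a) (V2) exactness … (w3)» + «the covariant-frame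
comparison costs O(d·B·ε) per stencil»).  THIS FILE: `liftSMTw k ψ A := byEntryTw (liftSL P k) ψ A`; `liftSMTw_id` (trivial frames = part 5's `liftSM`); ★ `liftSMTw_mem`
(`𝔰𝔲(N)`-valued for `𝔰𝔲(N)`-preserving frames); ★ `norm_liftSMTw_le` (`≤ (C_S∕L^k)·M` for contractive frames — SAME constant as the scalar `abs_liftS_le`); ★★
`norm_liftSMTw_sub_liftSM_le` (`≤ (C_S∕L^k)·θ·M`); ★★★ `norm_linAvgIterM_liftSMTw_sub_le` (`‖linAvgIterM k (liftSMTw k ψ A) c − A c‖ ≤ ((d+1)·C_S)·(θ·M)`, NO `k`).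
HONEST FRAMING.  Finite-dimensional real linear algebra; the frames `ψ` are ABSTRACT (no transport constructed); nothing of [Balaban1985UV3]∕[Balaban1985Variational]∕
[Balaban1985Averaging] is asserted; (FL), the stub 2′χ, the crux `HistoryTailL` and any gap are NOT claimed; count-neutral helper (`--supports stmt-QuantumFields-19936`);
registry untouched.  YM₃ on the three-torus is a RUNG of the programme, not the Clay problem; nothing here is about d = 4, infinite volume or a mass gap.

References: T. Bałaban, Commun. Math. Phys. 109 (1987) 249–301 [Balaban1987RG1] ((0.4), (0.11) p.253); Commun. Math. Phys. 98 (1985) 17–51 [Balaban1985Averaging] ((11) p.19,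
Prop. 4 (130)–(131) p.38); B. C. Hall, Lie Groups, Lie Algebras, and Representations (2015) [Hall2015] (Example 7.3).
-/

set_option autoImplicit false

noncomputable section

open scoped Matrix.Norms.L2Operator

namespace Summit.QuantumFields.YangMills.Theorems.LinearLiftMatrix

open Finset
open Literature.MathematicalPhysics.QuantumFieldTheory.Balaban1983to89
open Literature.MathematicalPhysics.QuantumFieldTheory.Balaban1985CMP102.Setting
open Summit.QuantumFields.Balaban3D.Carriers
open Summit.QuantumFields.YangMills.Theorems.LinearLiftSpread (liftS liftSL liftSL_apply)

section TwistedSmooth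

variable {P : Params} {n : Type*}

open scoped Classical in
/-- **THE TWISTED SUP-SMALL MATRIX LIFT**: ★w2 g2's `liftS k` in kernel form with per-pair frames `ψ` on the coefficients. [cite: Balaban1987RG1, (0.4)+(0.11) p.253; Balaban1985Averaging, (11) p.19] -/
def liftSMTw (k : ℕ) (ψ : PBond P 0 → PBond P k → Matrix n n ℂ →ₗ[ℝ] Matrix n n ℂ) (A : PBond P k → Matrix n n ℂ) : PBond P 0 → Matrix n n ℂ :=
  byEntryTw (liftSL P k) ψ A

variable (k : ℕ) (ψ : PBond P 0 → PBond P k → Matrix n n ℂ →ₗ[ℝ] Matrix n n ℂ)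

open scoped Classical in
/-- `liftSMTw` unfolded (classical decidability of bonds). [folklore] -/
theorem liftSMTw_eq (A : PBond P k → Matrix n n ℂ) : liftSMTw k ψ A = byEntryTw (liftSL P k) ψ A := rfl

/-- Trivial frames: `liftSMTw k id = liftSM k`. [cite: Balaban1987RG1, (0.4)+(0.11) p.253] -/
theorem liftSMTw_id (A : PBond P k → Matrix n n ℂ) (b : PBond P 0) : liftSMTw k (fun _ _ => LinearMap.id) A b = liftSM k A b := by
  classical
  rw [liftSMTw_eq, liftSM_eq, byEntry_congr (T := liftS k) (fun f => (liftSL_apply k f).symm)]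
  convert byEntryTw_id (liftSL P k) A b

/-- **★ THE TWISTED SUP-SMALL LIFT IS `𝔰𝔲(N)`-VALUED** for `𝔰𝔲(N)`-preserving frames and `𝔰𝔲(N)`-valued data (any `ℝ`-submodule). [cite: Hall2015, Example 7.3] -/
theorem liftSMTw_mem (S : Submodule ℝ (Matrix n n ℂ)) (hψ : ∀ b c X, X ∈ S → ψ b c X ∈ S) {A : PBond P k → Matrix n n ℂ} (hA : ∀ c, A c ∈ S) (b : PBond P 0) :
    liftSMTw k ψ A b ∈ S := by
  classical
  rw [liftSMTw_eq]
  convert byEntryTw_mem (liftSL P k) ψ S hψ hA b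

variable (hk : k ≤ P.m + P.K) [Fintype n] [DecidableEq n]
include hk

/-- **★ THE `L^{−k}`-SMALL SUP BOUND OF THE TWISTED LIFT** for contractive frames: `‖A c‖ ≤ M` ⇒ `‖liftSMTw k ψ A b‖ ≤ (C_S∕L^k)·M` (SAME constant as `abs_liftS_le`).
[cite: Balaban1987RG1, (0.4)+(0.11) p.253] -/
theorem norm_liftSMTw_le (hψ : ∀ b c X, ‖ψ b c X‖ ≤ ‖X‖) (A : PBond P k → Matrix n n ℂ) {M : ℝ} (hA : ∀ c, ‖A c‖ ≤ M) (b : PBond P 0) :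
    ‖liftSMTw k ψ A b‖ ≤ (CS P / (P.L : ℝ) ^ k) * M := by
  classical
  have hM : 0 ≤ M := (norm_nonneg _).trans (hA ⟨fun _ => 0, b.dir⟩)
  rw [liftSMTw_eq]
  convert norm_byEntryTw_le_of_bound (liftSL P k) ψ (fun _ => True) b (fun f M' hf => abs_liftS_le' k hk f (fun c => hf c trivial) b) (fun c _ X => hψ b c X) A hM
    (fun c _ => hA c) using 1

/-- **★★ THE FRAME-COMPARISON COST OF THE TWISTED SUP-SMALL LIFT**: frames `θ`-close to the identity move the lift by at most `(C_S∕L^k)·θ·M` in sup norm.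
[cite: Balaban1985Averaging, (11) p.19; Balaban1987RG1, (0.4) p.253] -/
theorem norm_liftSMTw_sub_liftSM_le {θ : ℝ} (hθ : 0 ≤ θ) (hψ : ∀ b c X, ‖ψ b c X - X‖ ≤ θ * ‖X‖) (A : PBond P k → Matrix n n ℂ) {M : ℝ} (hA : ∀ c, ‖A c‖ ≤ M)
    (b : PBond P 0) : ‖liftSMTw k ψ A b - liftSM k A b‖ ≤ (CS P / (P.L : ℝ) ^ k) * (θ * M) := by
  classical
  have hM : 0 ≤ M := (norm_nonneg _).trans (hA ⟨fun _ => 0, b.dir⟩)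
  rw [liftSMTw_eq, liftSM_eq, byEntry_congr (T := liftS k) (fun f => (liftSL_apply k f).symm)]
  convert norm_byEntryTw_sub_byEntry_le (liftSL P k) ψ (fun _ => True) b (fun f M' hf => abs_liftS_le' k hk f (fun c => hf c trivial) b) hθ
    (fun c _ X => hψ b c X) A hM (fun c _ => hA c) using 1

/-- **★★★ THE k-UNIFORM EXACTNESS DEFECT OF THE TWISTED SUP-SMALL LIFT**: `‖(Q₁^k (liftSMTw k ψ A))(c) − A c‖ ≤ ((d+1)·C_S)·(θ·M)` — EXACTNESS of `liftSM` (`linAvgIterM_liftSM`),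
linearity (`linAvgIterM_sub`) and the k-uniform sup bound of `Q₁^k` (`norm_linAvgIterM_le`, `(d+1)·L^k`) against the `L^{−k}` of the frame-comparison cost: NO `k` left.
[cite: Balaban1987RG1, (0.4)+(0.11) p.253; Balaban1985Averaging, (11) p.19] -/
theorem norm_linAvgIterM_liftSMTw_sub_le [Nonempty n] {θ : ℝ} (hθ : 0 ≤ θ) (hψ : ∀ b c X, ‖ψ b c X - X‖ ≤ θ * ‖X‖)
    (A : PBond P k → Matrix n n ℂ) {M : ℝ} (hA : ∀ c, ‖A c‖ ≤ M) (c : PBond P k) :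
    ‖linAvgIterM k (liftSMTw k ψ A) c - A c‖ ≤ (((P.d : ℝ) + 1) * CS P) * (θ * M) := by
  have hL : (0 : ℝ) < (P.L : ℝ) ^ k := by have := P.L_pos; positivity
  have hlin : linAvgIterM k (liftSMTw k ψ A) c - A c = linAvgIterM k (liftSMTw k ψ A - liftSM k A) c := by
    rw [linAvgIterM_sub, linAvgIterM_liftSM k hk A]
  rw [hlin]
  calc ‖linAvgIterM k (liftSMTw k ψ A - liftSM k A) c‖
      ≤ (((P.d : ℝ) + 1) * (P.L : ℝ) ^ k) * ((CS P / (P.L : ℝ) ^ k) * (θ * M)) :=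
        norm_linAvgIterM_le k _ (fun b => norm_liftSMTw_sub_liftSM_le k ψ hk hθ hψ A hA b) c
    _ = (((P.d : ℝ) + 1) * CS P) * (θ * M) := by field_simp

end TwistedSmooth

end Summit.QuantumFields.YangMills.Theorems.LinearLiftMatrix

end
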